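import Literature.AnabelianGeometry.SemiGraphs.QuasiTemperoidsComponents
import Literature.AlgebraicGeometry.Frobenioids.QuasiTemperoidConnectedPart
import HarnessLib

/-!
# Semi-graphs of anabelioids, Appendix: quotients of QD-pairs in `T[A] ⊆ B^temp(Π)` (proofs)

Mochizuki, *Semi-graphs of anabelioids*, Publ. RIMS **42** (2006), Appendix, Definition A.3 (iii),
manuscript p. 82 [cite: MochizukiSemiAnbd2006, Def A.3(iii) p.82]: "[Thus, the quotient of a QD-pair is
connected if and only if the QD-pair is weakly connected.]"  PROOF-ONLY companion of
`QuasiTemperoidsQDPairs.lean` (abc-iut-L3-t2), second of the files discharging the named fact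
`QDPair.QuotientConnectedIffWeaklyConnected`; here the statement is proved INSIDE A CHART
`T[A] = Over' A ⊆ B^temp(Π)` (the transport to an arbitrary connected quasi-temperoid along the chart
equivalence is the third file):

* `overPrime_exists_isQuotient` — EXISTENCE AND DESCRIPTION of quotients (Def. A.3 (iii)): given any
  `Γ`-invariant arrow `A' → C` of `T[A]`, the orbit `Π`-set `A'/Γ` (countable, open stabilisers, over `A`
  through `C`) is an object of `T[A]` and `A' → A'/Γ` forms a quotient of `(A', Γ)`, surjective on points
  with fibres the `Γ`-orbits;
* `overPrime_isQuotient_structure` — hence ANY quotient `φ : A' → B` of `(A', Γ)` is surjective on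
  points and identifies exactly the `Γ`-orbits (`B ≅ A'/Γ` by uniqueness of quotients);
* `overPrime_isConnectedObj_iff_isWeaklyConnected` — **the bracketed claim of Def. A.3 (iii) in a chart**:
  `B` is connected iff `(A', Γ)` is weakly connected, through the dictionary components ↔ `Π`-orbits of
  `QuasiTemperoidsComponents.lean` (`B ≅ A'/Γ` is one `Π`-orbit iff `Γ` permutes the `Π`-orbits of `A'`
  transitively).

No definitions; nothing here takes a side on [IUTchIII] Cor. 3.12.
-/

open CategoryTheory CategoryTheory.Limits Topology

namespace Literature.AnabelianGeometry.SemiGraphs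

open Literature.AlgebraicGeometry.Frobenioids (IsConnectedObj IsNonemptyObj)
open Literature.AlgebraicGeometry.Frobenioids.QuasiTemperoid.BTempConnected (hom_ρ hom_ext_apply
  ρ_one_apply ρ_mul_apply isIso_of_bijective)

universe u

variable {G : Type u} [Group G] [TopologicalSpace G] [IsTopologicalGroup G]

namespace QDPair

omit [IsTopologicalGroup G] in
/-- Composition of arrows of `T[A]`, on points. [folklore] -/
private theorem comp_apply {A : BTemp G} {X Y Z : Over' A} (f : X ⟶ Y) (g : Y ⟶ Z) (x : X.obj.obj.V) :
    (f ≫ g).hom.hom.hom x = g.hom.hom.hom (f.hom.hom.hom x) := rfl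

omit [IsTopologicalGroup G] in
/-- An automorphism of an object of `T[A]` is injective on points. [folklore] -/
private theorem aut_injective {A : BTemp G} {X : Over' A} (γ : Aut X) :
    Function.Injective fun a : X.obj.obj.V => (γ.hom.hom.hom.hom a : X.obj.obj.V) := by
  intro a a' h
  have e := congrArg (fun ψ : X ⟶ X => ψ.hom.hom.hom a) γ.hom_inv_id
  have e' := congrArg (fun ψ : X ⟶ X => ψ.hom.hom.hom a') γ.hom_inv_id
  change γ.inv.hom.hom.hom (γ.hom.hom.hom.hom a) = a at e
  change γ.inv.hom.hom.hom (γ.hom.hom.hom.hom a') = a' at e'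
  rw [← e, ← e']
  exact congrArg (fun b => (γ.inv.hom.hom.hom b : X.obj.obj.V)) h

/-- **Quotients of QD-pairs in `T[A]` EXIST as soon as some `Γ`-invariant arrow does, and are the
`Γ`-orbit `Π`-sets** (Def. A.3 (iii)): for a QD-pair `(A', Γ)` of `T[A]` and any `Γ`-invariant arrow
`ψ : A' → C` of `T[A]`, the `Π`-set `A'/Γ` of `Γ`-orbits (countable, open stabilisers — `Γ` consists of
`Π`-equivariant bijections — mapping to `A` through `C`) is an object of `T[A]`, the projection
`q : A' → A'/Γ` forms a quotient of `(A', Γ)` (universal among `Γ`-invariant arrows), `q` is surjective on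
points and identifies exactly the `Γ`-orbits.  (Without a `Γ`-invariant arrow no quotient can exist,
clause (a) of Def. A.3 (iii).) [cite: MochizukiSemiAnbd2006, Def A.3(iii) p.82] -/
theorem overPrime_exists_isQuotient {A : BTemp G} (P : QDPair (Over' A)) {C : Over' A}
    (ψ : P.A ⟶ C) (hψ : ∀ γ ∈ P.Γ, γ.hom ≫ ψ = ψ) :
    ∃ (B : Over' A) (q : P.A ⟶ B), P.IsQuotient q ∧
      Function.Surjective (fun a : P.A.obj.obj.V => (q.hom.hom.hom a : B.obj.obj.V)) ∧
        ∀ a a' : P.A.obj.obj.V, (q.hom.hom.hom a : B.obj.obj.V) = q.hom.hom.hom a' ↔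
          ∃ γ ∈ P.Γ, (γ.hom.hom.hom.hom a : P.A.obj.obj.V) = a' := by
  classical
  obtain ⟨pC⟩ := C.property
  let X : Over' A := P.A
  let V : Type u := X.obj.obj.V
  letI : MulAction G V := Action.instMulAction X.obj.obj
  -- `Γ`-invariance of `ψ`, on points
  have hinv : ∀ γ ∈ P.Γ, ∀ a : V, (ψ.hom.hom.hom (γ.hom.hom.hom.hom a) : C.obj.obj.V) = ψ.hom.hom.hom a :=
    fun γ hγ a => by
      have := congrArg (fun χ : X ⟶ C => (χ.hom.hom.hom a : C.obj.obj.V)) (hψ γ hγ)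
      exact this
  -- the `Γ`-orbit relation on the points of `A'`
  let rel : V → V → Prop := fun a a' => ∃ γ ∈ P.Γ, (γ.hom.hom.hom.hom a : V) = a'
  have rel_refl : ∀ a, rel a a := fun a => ⟨1, P.Γ.one_mem, rfl⟩
  have inv_apply : ∀ (γ : Aut X) (a : V), (γ.inv.hom.hom.hom (γ.hom.hom.hom.hom a) : V) = a :=
    fun γ a => congrArg (fun χ : X ⟶ X => (χ.hom.hom.hom a : V)) γ.hom_inv_id
  have rel_symm : ∀ {a a'}, rel a a' → rel a' a := by
    rintro a a' ⟨γ, hγ, rfl⟩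
    exact ⟨γ⁻¹, P.Γ.inv_mem hγ, inv_apply γ a⟩
  have rel_trans : ∀ {a a' a''}, rel a a' → rel a' a'' → rel a a'' := by
    rintro a a' a'' ⟨γ, hγ, rfl⟩ ⟨δ, hδ, rfl⟩
    exact ⟨δ * γ, P.Γ.mul_mem hδ hγ, rfl⟩
  let r : Setoid V := ⟨rel, ⟨rel_refl, rel_symm, rel_trans⟩⟩
  let W : Type u := Quotient r
  -- the `Π`-action on `A'/Γ` (`Γ` consists of `Π`-equivariant bijections)
  have hcompat : ∀ (g : G) (a a' : V), r a a' → r (g • a) (g • a') := fun g a a' ⟨γ, hγ, h⟩ =>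
    ⟨γ, hγ, by
      change (γ.hom.hom.hom.hom (X.obj.obj.ρ g a) : V) = X.obj.obj.ρ g a'
      rw [hom_ρ γ.hom.hom g a, h]⟩
  letI instW : MulAction G W :=
    { smul := fun g => Quotient.map' (fun a => g • a) (fun a a' h => hcompat g a a' h)
      one_smul := fun w => Quotient.inductionOn w fun a =>
        congrArg (Quotient.mk r) (one_smul G a)
      mul_smul := fun g g' w => Quotient.inductionOn w fun a =>
        congrArg (Quotient.mk r) (mul_smul g g' a) }
  have smul_mk : ∀ (g : G) (a : V), g • (Quotient.mk r a : W) = Quotient.mk r (g • a) := fun _ _ => rfl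
  haveI : Countable V := X.obj.property.1
  let Wb : BTemp G := ⟨Action.ofMulAction G W, inferInstanceAs (Countable (Quotient r)), fun w => by
    induction w using Quotient.inductionOn with
    | h a =>
      have hle : MulAction.stabilizer G a ≤ MulAction.stabilizer G (Quotient.mk r a : W) := by
        intro g hg
        rw [MulAction.mem_stabilizer_iff] at hg ⊢
        rw [smul_mk, hg]
      exact Subgroup.isOpen_mono hle (X.obj.property.2 a)⟩
  -- descending a `Γ`-invariant arrow `A' → D` of `T[A]` to `A'/Γ → D` (in `B^temp(Π)`)
  have descend : ∀ {D : Over' A} (χ : X ⟶ D), (∀ γ ∈ P.Γ, γ.hom ≫ χ = χ) →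
      ∃ χb : Wb ⟶ D.obj, ∀ a : V, (χb.hom.hom (Quotient.mk r a : W) : D.obj.obj.V) = χ.hom.hom.hom a := by
    intro D χ hχ
    have hχinv : ∀ γ ∈ P.Γ, ∀ a : V,
        (χ.hom.hom.hom (γ.hom.hom.hom.hom a) : D.obj.obj.V) = χ.hom.hom.hom a := fun γ hγ a => by
      have := congrArg (fun χ' : X ⟶ D => (χ'.hom.hom.hom a : D.obj.obj.V)) (hχ γ hγ)
      exact this
    refine ⟨ObjectProperty.homMk
      { hom := TypeCat.ofHom (Quotient.lift (fun a => (χ.hom.hom.hom a : D.obj.obj.V))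
          (fun a a' ⟨γ, hγ, h⟩ => by rw [← h]; exact (hχinv γ hγ a).symm))
        comm := fun g => by
          apply ConcreteCategory.hom_ext
          intro w
          induction w using Quotient.inductionOn with
          | h a => exact hom_ρ χ.hom g a }, fun a => rfl⟩
  obtain ⟨ψb, hψb⟩ := descend ψ hψ
  let Wo : Over' A := ⟨Wb, ⟨ψb ≫ pC⟩⟩
  let q : X ⟶ Wo := ObjectProperty.homMk (ObjectProperty.homMk
    { hom := TypeCat.ofHom (fun a : V => (Quotient.mk r a : W))
      comm := fun g => by
        apply ConcreteCategory.hom_ext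
        intro a
        rfl })
  have hq_inv : ∀ γ ∈ P.Γ, γ.hom ≫ q = q := fun γ hγ =>
    ObjectProperty.hom_ext _ (hom_ext_apply fun a =>
      Quotient.sound (r.iseqv.symm ⟨γ, hγ, rfl⟩))
  have hq_surj : Function.Surjective (fun a : V => (q.hom.hom.hom a : W)) := fun w =>
    Quotient.inductionOn w fun a => ⟨a, rfl⟩
  refine ⟨Wo, q, ⟨hq_inv, fun D χ hχ => ?_⟩, hq_surj, fun a a' => ⟨fun h => Quotient.exact h, ?_⟩⟩
  · -- universal property: descend `χ`, uniquely since `q` is surjective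
    obtain ⟨χb, hχb⟩ := descend χ hχ
    refine ⟨ObjectProperty.homMk χb, ObjectProperty.hom_ext _ (hom_ext_apply fun a => hχb a),
      fun κ hκ => ObjectProperty.hom_ext _ (hom_ext_apply fun w => ?_)⟩
    obtain ⟨a, rfl⟩ := hq_surj w
    replace hκ : q ≫ κ = χ := hκ
    have := congrArg (fun χ' : X ⟶ D => (χ'.hom.hom.hom a : D.obj.obj.V)) hκ
    exact this.trans (hχb a).symm
  · rintro ⟨γ, hγ, rfl⟩
    exact Quotient.sound ⟨γ, hγ, rfl⟩

/-- **The structure of ANY quotient of a QD-pair in `T[A]`** (Def. A.3 (iii)): if `φ : A' → B` forms a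
quotient of `(A', Γ)`, then `φ` is surjective on points and `φ a = φ a'` iff `a' = γ a` for some
`γ ∈ Γ` — `B ≅ A'/Γ` by the uniqueness of quotients (`IsQuotient.existsUnique_iso`, abc-iut-L3-t2)
applied to the orbit quotient of `overPrime_exists_isQuotient` (which exists since `φ` itself is a
`Γ`-invariant arrow). [cite: MochizukiSemiAnbd2006, Def A.3(iii) p.82] -/
theorem overPrime_isQuotient_structure {A : BTemp G} (P : QDPair (Over' A)) {B : Over' A}
    (φ : P.A ⟶ B) (hφ : P.IsQuotient φ) :
    Function.Surjective (fun a : P.A.obj.obj.V => (φ.hom.hom.hom a : B.obj.obj.V)) ∧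
      ∀ a a' : P.A.obj.obj.V, (φ.hom.hom.hom a : B.obj.obj.V) = φ.hom.hom.hom a' ↔
        ∃ γ ∈ P.Γ, (γ.hom.hom.hom.hom a : P.A.obj.obj.V) = a' := by
  obtain ⟨B₀, q, hq, hsurj, hker⟩ := overPrime_exists_isQuotient P φ hφ.1
  obtain ⟨e, he, -⟩ := hq.existsUnique_iso hφ
  replace he : q ≫ e.hom = φ := he
  -- `φ = q ≫ e.hom` with `e` an isomorphism: transfer surjectivity and the fibres through `e`
  have hφa : ∀ a, (φ.hom.hom.hom a : B.obj.obj.V) = e.hom.hom.hom.hom (q.hom.hom.hom a) := fun a => by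
    rw [← he]; rfl
  have einv : ∀ b : B₀.obj.obj.V, (e.inv.hom.hom.hom (e.hom.hom.hom.hom b) : B₀.obj.obj.V) = b :=
    fun b => congrArg (fun χ : B₀ ⟶ B₀ => (χ.hom.hom.hom b : B₀.obj.obj.V)) e.hom_inv_id
  have einv' : ∀ b : B.obj.obj.V, (e.hom.hom.hom.hom (e.inv.hom.hom.hom b) : B.obj.obj.V) = b :=
    fun b => congrArg (fun χ : B ⟶ B => (χ.hom.hom.hom b : B.obj.obj.V)) e.inv_hom_id
  refine ⟨fun b => ?_, fun a a' => ?_⟩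
  · obtain ⟨a, ha⟩ := hsurj (e.inv.hom.hom.hom b)
    refine ⟨a, ?_⟩
    change (φ.hom.hom.hom a : B.obj.obj.V) = b
    rw [hφa]
    change (q.hom.hom.hom a : B₀.obj.obj.V) = e.inv.hom.hom.hom b at ha
    rw [ha, einv']
  · rw [← hker a a', hφa, hφa]
    exact ⟨fun h => by simpa only [einv] using congrArg (fun b => (e.inv.hom.hom.hom b : B₀.obj.obj.V)) h,
      fun h => by rw [h]⟩

omit [IsTopologicalGroup G] in
/-- A non-initial object of `T[A]` whose points all come from `φ : A' → B` surjective … (helper): an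
object of `T[A]` with a point is non-initial. [cite: MochizukiSemiAnbd2006, Appendix p.79] -/
private theorem isNonemptyObj_of_point {A : BTemp G} {X : Over' A} (x : X.obj.obj.V) :
    IsNonemptyObj X :=
  ⟨fun hI => (overPrime_isEmpty_of_isInitial hI).false x⟩

/-- **Definition A.3 (iii), bracket, inside a chart `T[A] ⊆ B^temp(Π)`**: for a QD-pair `(A', Γ)` of
`T[A]` and `φ : A' → B` forming its quotient, `B` is connected if and only if `(A', Γ)` is weakly
connected.  (`B ≅ A'/Γ` as `Π`-sets by `overPrime_isQuotient_structure`; `B` is connected iff it is a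
single `Π`-orbit; the components of `A'` are its `Π`-orbits, so `A'/Γ` is a single `Π`-orbit iff `Γ`
permutes the components of `A'` transitively.) [cite: MochizukiSemiAnbd2006, Def A.3(iii) p.82] -/
theorem overPrime_isConnectedObj_iff_isWeaklyConnected {A : BTemp G} (P : QDPair (Over' A))
    {B : Over' A} (φ : P.A ⟶ B) (hφ : P.IsQuotient φ) : IsConnectedObj B ↔ P.IsWeaklyConnected := by
  classical
  obtain ⟨hsurj, hker⟩ := overPrime_isQuotient_structure P φ hφ
  let X : Over' A := P.A
  letI : MulAction G X.obj.obj.V := Action.instMulAction X.obj.obj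
  letI : MulAction G B.obj.obj.V := Action.instMulAction B.obj.obj
  constructor
  · intro hB
    obtain ⟨⟨b₀⟩, htrans⟩ := (overPrime_isConnectedObj_iff_transitive B).mp hB
    obtain ⟨a₀, -⟩ := hsurj b₀
    refine ⟨isNonemptyObj_of_point a₀, fun C₁ C₂ ι₁ ι₂ h₁ h₂ => ?_⟩
    obtain ⟨c₁⟩ := h₁.nonempty
    obtain ⟨c₂⟩ := h₂.nonempty
    -- a `γ ∈ Γ` carrying (a translate of) `ι₁ c₁` to `ι₂ c₂`
    obtain ⟨g, hg⟩ := htrans (φ.hom.hom.hom (ι₁.hom.hom.hom c₁)) (φ.hom.hom.hom (ι₂.hom.hom.hom c₂))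
    rw [← hom_ρ φ.hom g] at hg
    obtain ⟨γ, hγ, hγa⟩ := (hker _ _).mp hg
    -- the map `C₁ → C₂`: `ι₂ (f c) = γ (ι₁ c)`
    have hex : ∀ c : C₁.obj.obj.V, ∃ c' : C₂.obj.obj.V,
        (ι₂.hom.hom.hom c' : X.obj.obj.V) = γ.hom.hom.hom.hom (ι₁.hom.hom.hom c) := by
      intro c
      obtain ⟨h, hh⟩ := h₁.exists_ρ_eq c₁ c
      refine ⟨C₂.obj.obj.ρ (h * g⁻¹) c₂, ?_⟩
      rw [hom_ρ ι₂.hom, ← hγa, ← hom_ρ γ.hom.hom, ← hh]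
      change (γ.hom.hom.hom.hom ((h * g⁻¹) • g • ι₁.hom.hom.hom c₁) : X.obj.obj.V) =
        γ.hom.hom.hom.hom (h • ι₁.hom.hom.hom c₁)
      rw [mul_smul, inv_smul_smul]
    choose f hf using hex
    have hfρ : ∀ (k : G) (c : C₁.obj.obj.V), f (C₁.obj.obj.ρ k c) = C₂.obj.obj.ρ k (f c) := by
      intro k c
      apply h₂.injective
      change (ι₂.hom.hom.hom (f (C₁.obj.obj.ρ k c)) : X.obj.obj.V) = ι₂.hom.hom.hom (C₂.obj.obj.ρ k (f c))
      rw [hf, hom_ρ ι₂.hom, hf, hom_ρ ι₁.hom, hom_ρ γ.hom.hom]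
    have hfinj : Function.Injective f := by
      intro c c' h
      apply h₁.injective
      apply aut_injective γ
      change (γ.hom.hom.hom.hom (ι₁.hom.hom.hom c) : X.obj.obj.V) = γ.hom.hom.hom.hom (ι₁.hom.hom.hom c')
      rw [← hf, ← hf, h]
    have hfsurj : Function.Surjective f := by
      intro c'
      obtain ⟨k, hk⟩ := h₂.exists_ρ_eq c₂ c'
      refine ⟨C₁.obj.obj.ρ (k * g) c₁, h₂.injective ?_⟩
      change (ι₂.hom.hom.hom (f (C₁.obj.obj.ρ (k * g) c₁)) : X.obj.obj.V) = ι₂.hom.hom.hom c'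
      rw [hf, hom_ρ ι₁.hom, ← hk, ← hγa, ← hom_ρ γ.hom.hom]
      change (γ.hom.hom.hom.hom ((k * g) • ι₁.hom.hom.hom c₁) : X.obj.obj.V) =
        γ.hom.hom.hom.hom (k • g • ι₁.hom.hom.hom c₁)
      rw [mul_smul]
    let fC : C₁ ⟶ C₂ := ObjectProperty.homMk (ObjectProperty.homMk
      { hom := TypeCat.ofHom f
        comm := fun k => by
          apply ConcreteCategory.hom_ext
          intro c
          exact hfρ k c })
    haveI : IsIso fC.hom := isIso_of_bijective fC.hom ⟨hfinj, hfsurj⟩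
    refine ⟨γ, hγ, ObjectProperty.isoMk _ (asIso fC.hom), ?_⟩
    apply ObjectProperty.hom_ext
    apply hom_ext_apply
    intro c
    exact (hf c).symm
  · rintro ⟨hne, hcomp⟩
    obtain ⟨a₀⟩ := overPrime_nonempty_of_isNonemptyObj hne
    refine (overPrime_isConnectedObj_iff_transitive B).mpr ⟨⟨φ.hom.hom.hom a₀⟩, fun b b' => ?_⟩
    obtain ⟨a, rfl⟩ := hsurj b
    obtain ⟨a', rfl⟩ := hsurj b'
    obtain ⟨C₁, ι₁, hι₁, hr₁⟩ := overPrime_exists_isComponent_orbit X a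
    obtain ⟨C₂, ι₂, hι₂, hr₂⟩ := overPrime_exists_isComponent_orbit X a'
    obtain ⟨γ, hγ, e, he⟩ := hcomp ι₁ ι₂ hι₁ hι₂
    obtain ⟨c₁, hc₁⟩ := (hr₁ a).mpr ⟨1, ρ_one_apply X.obj a⟩
    -- `γ a = ι₂ (e c₁)` lies in the `Π`-orbit of `a'`
    have hmem : ∃ c : C₂.obj.obj.V, (ι₂.hom.hom.hom c : X.obj.obj.V) = γ.hom.hom.hom.hom a := by
      refine ⟨e.hom.hom.hom.hom c₁, ?_⟩
      rw [← comp_apply e.hom ι₂, ← he, comp_apply, hc₁]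
    obtain ⟨g, hg⟩ := (hr₂ _).mp hmem
    -- so `φ a = φ (γ a) = φ (g a') = g (φ a')`
    refine ⟨g⁻¹, ?_⟩
    change g⁻¹ • (φ.hom.hom.hom a : B.obj.obj.V) = φ.hom.hom.hom a'
    rw [inv_smul_eq_iff]
    change (φ.hom.hom.hom a : B.obj.obj.V) = B.obj.obj.ρ g (φ.hom.hom.hom a')
    rw [← hom_ρ φ.hom g a', hg]
    exact ((hker a _).mpr ⟨γ, hγ, rfl⟩)

end QDPair

end Literature.AnabelianGeometry.SemiGraphs
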